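import Summits.AtomisticToContinuum.HydrodynamicLimit.Theorems.RelayRaceLocalityNearConstantShortTimeHLGoodEvents
import HarnessLib

/-!
# Crux `NearConstantShortTimeHL` (stmt-AtomisticToContinuum-12502), line `small-tilt-domination` — indexed good events

Lead c8, stub `exists_goodEvents_of_importI` of the v18 skeleton: the GOOD-EVENT EXTRACTION of the relative-entropy
Grönwall assembly, in the variant where the cap-failure events are INDEXED by the grid size `i`.
Data: the true laws `P N`, invariant reference laws `G N` with the EVENT IMPORT `P N A ≤ e^{a n_N} · G N A` (tilt
domination), finitely many (`q < Q i`) closure-defect events `E i q N` of grid size `i`, each of `G`-probability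
`≤ e^{-c₀ n_N}` eventually in `N`, a rate gap `a < c₀`, side conditions `p i N` valid eventually in `N` for each
fixed `i`, and cap-failure events `B i N` with `P N (B i N) ≤ b i` eventually in `N` for each fixed `i`, where
`b i → 0` in `ℝ≥0∞`.
`exists_goodEvents_of_importI`: there is a diagonal grid index `ι(N) → ∞` (from the landed `exists_diagonal_index`)
with `p (ι N) N` eventually, and MEASURABLE good events `G' N` of `P`-probability `→ 1` avoiding the diagonal cap
failure `B (ι N) N` and every indexed defect event `E (ι N) q N`, `q < Q (ι N)`.  The bad set
`B (ι N) N ∪ ⋃_{q < Q (ι N)} E (ι N) q N` has `P`-mass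
`≤ b (ι N) + Q (ι N) · e^{(a - c₀) n_N} ≤ b (ι N) + 1/(ι N + 1) → 0` (eventually); `G' N` is the complement of its
measurable hull.  The proof is the landed `exists_goodEvents_of_import` (v17 skeleton) with the bound
`P N (B i N) ≤ b i` threaded through the combined eventual property.
All estimates live in `ℝ≥0∞`; no finiteness of the measures is used.
-/

namespace Summit.AtomisticToContinuum.HydrodynamicLimit.Theorems.NearConstantShortTimeHL

open scoped BigOperators ENNReal
open MeasureTheory Set Filter

/-- **Good-event extraction, indexed bad sets.** Under the event import `P N A ≤ e^{a n_N} G N A`,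
`G`-exponential smallness `G N (E i q N) ≤ e^{-c₀ n_N}` (eventually, for each fixed grid index `i` and each of the
`Q i` defect events) with `a < c₀`, side conditions `p i N` valid eventually for each fixed `i`, and indexed cap
failures `P N (B i N) ≤ b i` eventually for each fixed `i` with `b i → 0`, there are a diagonal index `ι(N) → ∞`
with `p (ι N) N` eventually and measurable good events `G' N` with `P N (G' N)ᶜ → 0`, and eventually
`G' N ⊆ (B (ι N) N)ᶜ` and `G' N ⊆ (E (ι N) q N)ᶜ` for all `q < Q (ι N)`. [folklore] -/
theorem exists_goodEvents_of_importI : ∀ {Ω : ℕ → Type*} [∀ N, MeasurableSpace (Ω N)]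
    (P G : (N : ℕ) → MeasureTheory.Measure (Ω N)) (n : ℕ → ℕ), Filter.Tendsto n Filter.atTop Filter.atTop →
    ∀ {a c₀ : ℝ}, a < c₀ →
    (∀ N (A : Set (Ω N)), P N A ≤ ENNReal.ofReal (Real.exp (a * n N)) * G N A) →
    ∀ (Q : ℕ → ℕ) (E : (i q N : ℕ) → Set (Ω N)),
    (∀ i, ∀ q < Q i, ∀ᶠ N in Filter.atTop, G N (E i q N) ≤ ENNReal.ofReal (Real.exp (-(c₀ * n N)))) →
    ∀ (p : ℕ → ℕ → Prop), (∀ i, ∀ᶠ N in Filter.atTop, p i N) →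
    ∀ (B : (i N : ℕ) → Set (Ω N)) (b : ℕ → ENNReal), Filter.Tendsto b Filter.atTop (nhds 0) →
    (∀ i, ∀ᶠ N in Filter.atTop, P N (B i N) ≤ b i) →
    ∃ ι : ℕ → ℕ, Filter.Tendsto ι Filter.atTop Filter.atTop ∧ (∀ᶠ N in Filter.atTop, p (ι N) N) ∧
      ∃ G' : (N : ℕ) → Set (Ω N), (∀ N, MeasurableSet (G' N)) ∧
        Filter.Tendsto (fun N => P N (G' N)ᶜ) Filter.atTop (nhds 0) ∧
        ∀ᶠ N in Filter.atTop, G' N ⊆ (B (ι N) N)ᶜ ∧ ∀ q < Q (ι N), G' N ⊆ (E (ι N) q N)ᶜ := by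
  intro Ω _ P G n hn a c₀ hac himp Q E hE p hp B b hb hPB
  -- (1) the combined eventual property for each FIXED index `i` (side condition, cap failure, defects, rate gap)
  have hcomb : ∀ i, ∀ᶠ N in atTop, p i N ∧ P N (B i N) ≤ b i ∧
      (∀ q ∈ Finset.range (Q i), G N (E i q N) ≤ ENNReal.ofReal (Real.exp (-(c₀ * n N)))) ∧
      (Q i : ℝ) * (Real.exp (a * n N) * Real.exp (-(c₀ * n N))) ≤ 1 / ((i : ℝ) + 1) := by
    intro i
    refine (hp i).and ((hPB i).and (((Finset.range (Q i)).eventually_all.2 fun q hq =>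
      hE i q (Finset.mem_range.1 hq)).and ?_))
    have h0 : (0 : ℝ) < 1 / ((i : ℝ) + 1) := by positivity
    exact (xg_tendsto_count_mul_exp_zero hn hac (Q i)).eventually_le_const h0
  -- (2) the diagonal index
  obtain ⟨ι, hι, hιp⟩ := exists_diagonal_index hcomb
  -- (3) bad sets and good events
  let B' : (N : ℕ) → Set (Ω N) := fun N => B (ι N) N ∪ ⋃ q ∈ Finset.range (Q (ι N)), E (ι N) q N
  let G' : (N : ℕ) → Set (Ω N) := fun N => (toMeasurable (P N) (B' N))ᶜ
  refine ⟨ι, hι, hιp.mono fun N hN => hN.1, G', fun N => (measurableSet_toMeasurable _ _).compl, ?_, ?_⟩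
  · -- (4)-(5) `P N (G' N)ᶜ = P N (B' N) ≤ b (ι N) + 1/(ι N + 1) → 0`
    have hbound : ∀ᶠ N in atTop, P N (G' N)ᶜ ≤ b (ι N) + ENNReal.ofReal (1 / ((ι N : ℝ) + 1)) := by
      filter_upwards [hιp] with N hN
      obtain ⟨_, hBb, hGE, hsmall⟩ := hN
      have h1 : P N (G' N)ᶜ = P N (B' N) := by
        show P N (toMeasurable (P N) (B' N))ᶜᶜ = P N (B' N)
        rw [compl_compl, measure_toMeasurable]
      rw [h1]
      calc P N (B' N) ≤ P N (B (ι N) N) + P N (⋃ q ∈ Finset.range (Q (ι N)), E (ι N) q N) :=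
            measure_union_le _ _
        _ ≤ b (ι N) + ∑ q ∈ Finset.range (Q (ι N)), P N (E (ι N) q N) := by
          gcongr
          exact measure_biUnion_finset_le _ _
        _ ≤ b (ι N) + ∑ q ∈ Finset.range (Q (ι N)),
            ENNReal.ofReal (Real.exp (a * n N)) * ENNReal.ofReal (Real.exp (-(c₀ * n N))) := by
          gcongr with q hq
          calc P N (E (ι N) q N) ≤ ENNReal.ofReal (Real.exp (a * n N)) * G N (E (ι N) q N) := himp N _
            _ ≤ _ := by
              gcongr
              exact hGE q hq
        _ = b (ι N) + ENNReal.ofReal ((Q (ι N) : ℝ) * (Real.exp (a * n N) * Real.exp (-(c₀ * n N)))) := by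
          rw [Finset.sum_const, Finset.card_range, nsmul_eq_mul, ENNReal.ofReal_mul (Nat.cast_nonneg _),
            ENNReal.ofReal_natCast, ENNReal.ofReal_mul (Real.exp_pos _).le]
        _ ≤ b (ι N) + ENNReal.ofReal (1 / ((ι N : ℝ) + 1)) := by
          gcongr
    have hlim : Tendsto (fun N => b (ι N) + ENNReal.ofReal (1 / ((ι N : ℝ) + 1))) atTop (nhds 0) := by
      have h1 : Tendsto (fun N => ENNReal.ofReal (1 / ((ι N : ℝ) + 1))) atTop (nhds 0) := by
        have := ENNReal.tendsto_ofReal ((tendsto_one_div_add_atTop_nhds_zero_nat (𝕜 := ℝ)).comp hι)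
        simpa using this
      have h2 : Tendsto (fun N => b (ι N)) atTop (nhds 0) := hb.comp hι
      simpa using h2.add h1
    exact tendsto_of_tendsto_of_tendsto_of_le_of_le' tendsto_const_nhds hlim
      (Eventually.of_forall fun _ => zero_le) hbound
  · -- avoidance (valid for every `N`)
    refine Eventually.of_forall fun N => ?_
    have hsub : G' N ⊆ (B' N)ᶜ := compl_subset_compl.2 (subset_toMeasurable _ _)
    refine ⟨hsub.trans (compl_subset_compl.2 subset_union_left), fun q hq =>
      hsub.trans (compl_subset_compl.2 (subset_union_of_subset_right ?_ _))⟩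
    exact Set.subset_iUnion₂ (s := fun q (_ : q ∈ Finset.range (Q (ι N))) => E (ι N) q N) q
      (Finset.mem_range.2 hq)

end Summit.AtomisticToContinuum.HydrodynamicLimit.Theorems.NearConstantShortTimeHL
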